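import Summits.SmoothPoincare4.SmoothPoincare4.Theses.SblfDescent
import Literature.Topology.FourManifolds.SimplifiedBrokenLefschetzFibration

/-!
# SmoothPoincare4 / SblfDescent — crux `StepGE3`, line `Sketch` (class-wise descent): lead skeleton

Crux item stmt-SmoothPoincare4-18528, route decl
`Summit.SmoothPoincare4.SmoothPoincare4.Theses.SblfDescent.StepGE3`:
for every smooth `M ≃ₕ S⁴` and every `h ≥ 1`, an SBLF of lower genus `h + 1` on `M` yields one of
lower genus `h` (the route's inline predicate `HAS(M, n)` is, field for field,
`∃ o f L, Literature.Topology.FourManifolds.IsSimplifiedBrokenLefschetzFibration o f L n`).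

Line `Sketch` (crux-ideate r1 k1, card `arf-class-two-ladders`): split the input fibration map
`f : M → S²` by its free homotopy class in `[M, S²] ≅ π₄(S²) ≅ ℤ/2` — NULL-HOMOTOPIC (ε = 0) or
ESSENTIAL (ε = 1) — and descend each class separately ("class-preserving un-flip recognition aimed
at the class bottom": the ADK/Hayano tower for ε = 0, the Matsumoto-derived genus-2 system for
ε = 1).  The composition `StepGE3_of` is the case split; the two stubs are the two halves.

Stubs (registered with `ledger skeleton check … --crux stmt-SmoothPoincare4-18528`):
* `stub_classNull`      — descent of null-homotopic SBLFs of lower genus `h + 1 ≥ 2`;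
* `stub_classEssential` — descent of essential SBLFs of lower genus `h + 1 ≥ 2` (lead's stub).
Both are stated over tree vocabulary only (`IsSimplifiedBrokenLefschetzFibration`,
`ContinuousMap.Homotopic`, `ContinuousMap.const`), so that `--supports` files can restate them
verbatim.
-/

set_option linter.dupNamespace false

namespace Summit.SmoothPoincare4.SmoothPoincare4.Theorems

open scoped Manifold ContDiff Topology ContinuousMap

/-- **Stub (line Sketch, class ε = 0): descent of NULL-HOMOTOPIC simplified broken Lefschetz
fibrations.**  For a smooth homotopy 4-sphere `M`, `h ≥ 1`, and an SBLF `f : M → S²` of lower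
genus `h + 1` (structure `IsSimplifiedBrokenLefschetzFibration o f L (h + 1)`) whose underlying
continuous map is homotopic to a constant, `M` admits an SBLF of lower genus `h`.
Card arf-class-two-ladders, K1 at ε = 0. -/
theorem stub_classNull :
    ∀ (M : Type) [TopologicalSpace M] [T2Space M] [SecondCountableTopology M]
      [ChartedSpace (EuclideanSpace ℝ (Fin 4)) M]
      [IsManifold (𝓡 4) ((⊤ : ℕ∞) : WithTop ℕ∞) M],
      M ≃ₕ Metric.sphere (0 : EuclideanSpace ℝ (Fin 5)) 1 → ∀ h : ℕ, 1 ≤ h →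
      ∀ (o : Literature.Topology.FourManifolds.SmoothOrientation (𝓡 4) M)
        (f : M → Metric.sphere (0 : EuclideanSpace ℝ (Fin 3)) 1) (L : Finset M)
        (hf : Literature.Topology.FourManifolds.IsSimplifiedBrokenLefschetzFibration o f L (h + 1)),
        (∃ y₀ : Metric.sphere (0 : EuclideanSpace ℝ (Fin 3)) 1,
            (⟨f, hf.contMDiff.continuous⟩ :
                C(M, Metric.sphere (0 : EuclideanSpace ℝ (Fin 3)) 1)).Homotopic
              (ContinuousMap.const M y₀)) →
        ∃ (o' : Literature.Topology.FourManifolds.SmoothOrientation (𝓡 4) M)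
          (f' : M → Metric.sphere (0 : EuclideanSpace ℝ (Fin 3)) 1) (L' : Finset M),
          Literature.Topology.FourManifolds.IsSimplifiedBrokenLefschetzFibration o' f' L' h := by
  sorry

/-- **Stub (line Sketch, class ε = 1): descent of ESSENTIAL simplified broken Lefschetz
fibrations** (the lead's stub).  For a smooth homotopy 4-sphere `M`, `h ≥ 1`, and an SBLF
`f : M → S²` of lower genus `h + 1` whose underlying continuous map is NOT homotopic to a
constant (the generator of `[M, S²] ≅ π₄(S²) ≅ ℤ/2`), `M` admits an SBLF of lower genus `h`.
Card arf-class-two-ladders, K1 at ε = 1. -/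
theorem stub_classEssential :
    ∀ (M : Type) [TopologicalSpace M] [T2Space M] [SecondCountableTopology M]
      [ChartedSpace (EuclideanSpace ℝ (Fin 4)) M]
      [IsManifold (𝓡 4) ((⊤ : ℕ∞) : WithTop ℕ∞) M],
      M ≃ₕ Metric.sphere (0 : EuclideanSpace ℝ (Fin 5)) 1 → ∀ h : ℕ, 1 ≤ h →
      ∀ (o : Literature.Topology.FourManifolds.SmoothOrientation (𝓡 4) M)
        (f : M → Metric.sphere (0 : EuclideanSpace ℝ (Fin 3)) 1) (L : Finset M)
        (hf : Literature.Topology.FourManifolds.IsSimplifiedBrokenLefschetzFibration o f L (h + 1)),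
        (¬ ∃ y₀ : Metric.sphere (0 : EuclideanSpace ℝ (Fin 3)) 1,
            (⟨f, hf.contMDiff.continuous⟩ :
                C(M, Metric.sphere (0 : EuclideanSpace ℝ (Fin 3)) 1)).Homotopic
              (ContinuousMap.const M y₀)) →
        ∃ (o' : Literature.Topology.FourManifolds.SmoothOrientation (𝓡 4) M)
          (f' : M → Metric.sphere (0 : EuclideanSpace ℝ (Fin 3)) 1) (L' : Finset M),
          Literature.Topology.FourManifolds.IsSimplifiedBrokenLefschetzFibration o' f' L' h := by
  sorry

/-- **Composition (line Sketch): `StepGE3` from its two class-wise halves.**  Unpack the route's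
inline `HAS(M, h + 1)` into `IsSimplifiedBrokenLefschetzFibration o f L (h + 1)` (the clauses are
the fields, in order), split on whether `f` is null-homotopic, apply the stub of that class, and
repack the resulting genus-`h` structure into the route's inline `HAS(M, h)`.  Sorry-free apart
from the two stubs; concludes the crux BY NAME. -/
theorem StepGE3_of : Summit.SmoothPoincare4.SmoothPoincare4.Theses.SblfDescent.StepGE3 := by
  intro M _ _ _ _ _ e h hh hM
  obtain ⟨o, f, L, h1, h2, h3, h4, h5, h6, h7, h8, h9, h10⟩ := hM
  have hS : Literature.Topology.FourManifolds.IsSimplifiedBrokenLefschetzFibration o f L (h + 1) :=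
    ⟨h1, h2, h3, h4, h5, h6, h7, h8, h9, h10⟩
  have key : ∃ (o' : Literature.Topology.FourManifolds.SmoothOrientation (𝓡 4) M)
      (f' : M → Metric.sphere (0 : EuclideanSpace ℝ (Fin 3)) 1) (L' : Finset M),
      Literature.Topology.FourManifolds.IsSimplifiedBrokenLefschetzFibration o' f' L' h := by
    by_cases hnull : ∃ y₀ : Metric.sphere (0 : EuclideanSpace ℝ (Fin 3)) 1,
        (⟨f, hS.contMDiff.continuous⟩ :
            C(M, Metric.sphere (0 : EuclideanSpace ℝ (Fin 3)) 1)).Homotopic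
          (ContinuousMap.const M y₀)
    · exact stub_classNull M e h hh o f L hS hnull
    · exact stub_classEssential M e h hh o f L hS hnull
  obtain ⟨o', f', L', g1, g2, g3, g4, g5, g6, g7, g8, g9, g10⟩ := key
  exact ⟨o', f', L', g1, g2, g3, g4, g5, g6, g7, g8, g9, g10⟩

end Summit.SmoothPoincare4.SmoothPoincare4.Theorems
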